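import Summits.CriticalPhenomena.PercolationContinuityZ3.Theorems.PercNearOneGluingNoHeavyLowerTailAntitheticTwoStageCone
import Summits.CriticalPhenomena.PercolationContinuityZ3.Theorems.PercNearOneGluingNoHeavyLowerTailAntitheticHandlePrincipleShift
import HarnessLib

/-!
# `NoHeavyLowerTail` (stmt-CriticalPhenomena-4575) — antithetic cluster pairs: **THEOREM M1 — the mixed shifted-BIC sum (M)_shift of a
# ROOTED CONE at an EDGE is nonnegative**, structurally (no certificate, every cone `s * H`, `H` arbitrary), and **THEOREM CE — cone + ear**:
# CONJECTURE Δ2 / the vertex antithetic inequality at `R = {x}` for `s * H` plus a path `P – u 1 – … – u a = y – x – Q` returning to a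
# neighbour `Q` of `P` in `H` (or to `P` itself), all lengths `a ≥ 0` (prim-hp-2 gen 67, HOME/MEMO-gen67.md §2)

Support file (`--supports stmt-CriticalPhenomena-4575`, hull-port prover `prim-hp-2`, gen 67).  No definitions, no named facts, no sorries;
standard axioms.  VERTEX version, setting and notation of …AntitheticConeFibre / …AntitheticTwoStageCone (`T ⊆ Sym2 V` the red pairs,
`X T = openCluster (T ∩ E) s`, `Y T = openCluster (Tᶜ ∩ E) s`).

THE OBSERVATION.  The handle machinery re-based on the shifted-BIC class `𝒮_shift = {F⁺(X) − F⁻(Y) : F⁻ ≤ F⁺ monotone}`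
(…AntitheticHandlePrincipleShift) needs, when the `z`-arm has length `0` (`x` adjacent to `Q`), ONLY the mixed hypothesis
  (M)_shift(E; P, Q):  `0 ≤ Σ_{T : P ∈ X T, Q ∉ Y T} (F⁺(X T) − F⁻(Y T))·(G⁺(X T) − G⁻(Y T))`.
Condition on the blue vertex cluster `S` of `Q` (BHK's fibres, as in THEOREM R = …AntitheticTwoStageCone): `Q ∉ Y T ⟺ s ∉ S`; under the cone
hypothesis at `Q` (every vertex of a blue cluster of `Q` missing `s` is adjacent to `s`) the pair `(X, Y)` on the fibre `{B T = S}` is the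
pair of the configuration with every pair meeting `S` recoloured red (`Cone.fibre_red/blue`), so (`Cone.cond_sum`) the event sum is a
nonnegative mixture of FULL sums `Σ_{T'} Φ(X(T' ∪ M_S), Y(T' ∪ M_S))` — provided the event `{P ∈ X}` is automatic on every fibre, which is the
case exactly when `P = Q` or `PQ ∈ E` (the pair `PQ` meets `S ∋ Q`, hence is red on the fibre, and `Q` hangs on the red spoke `sQ`).  A full
sum is nonnegative for the shifted class with NO hypothesis: Harris in the fresh variables (`Cone.harris_real`) and
`Σ_{T'} F⁺(X(T' ∪ M)) − F⁻(Y(T' ∪ M)) ≥ Σ_{T'} F⁻(X T') − F⁻(Y T') = 0` (more red pairs enlarge `X`, shrink `Y`; antithetic symmetry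
`Cone.sum_compl_inter`).  No positive association of the mixing law is needed (contrast THEOREM R, which needs BHK Thm 1.3).
* `Antithetic.TwoStage.Cone.shift_full_sum_nonneg` — the full shifted sum with a forced-red pair set `M` is `≥ 0`.
* `Antithetic.TwoStage.Cone.mem_red_of_blue_cluster` — under the cone hypothesis at `Q`, `Q ∉ Y T` forces `P ∈ X T` for `P ∈ N[Q]`.
* `Antithetic.TwoStage.Cone.mixed_shift_nonneg` — **THEOREM M1**: (M)_shift(E; P, Q) for every `E, s, Q` with the cone hypothesis at `Q`
  (every rooted cone `s * H`, `Cone.hcone_of_cone`; further blocks at `s` allowed) and every `P ∈ {Q} ∪ N_E(Q)`.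
* `Antithetic.TwoStage.Cone.ear_vertex_sum_nonneg` — **THEOREM CE (cone + ear)**: `E₀` loop-free with the cone hypothesis at `Q`, `P = Q` or
  `PQ ∈ E₀`, an arm `u 0 = P, …, u a = y` of fresh vertices (`a ≥ 0`), `x` fresh joined to `y` and to `Q` (`y ≠ Q`): for all monotone `F, G`,
  `0 ≤ Σ_{ω : ¬(x ∈ X ω ∧ x ∈ Y ω)} (F(X ω) − F(Y ω))·(G(X ω) − G(Y ω))` for the edge set `E₀ ∪ arm + xy + xQ`.  The degree-2
  reduction underneath (…AntitheticDegTwoOneSided) needs `yQ ∉ E₀ ∪ arm`, so the hypotheses are consistent only for `a ≥ 1` (for `a = 0`,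
  `y = P` and `hPQ`/`hg` clash): the instances are cones `s * H` plus an EAR OF LENGTH ≥ 3 between the ends of an edge `PQ` of `H`
  (`x` the ear vertex next to `Q`), e.g. every wheel or fan with such an ear on a rim / hub–leaf edge — the fans `s * K_{1,k}`, `k ≥ 5`,
  FAIL the K-form ⊕ at the hub (HOME/MEMO-gen65 §3(c)), so no handle theorem with a stub arm starts there; THEOREM CE does not care.
  (CORRECTION of the first submission's docstring, which advertised the vacuous `a = 0` case "x on the two ends of an edge".)
[cite: VandenbergHaggstromKahn2005, §1 pp. 7–8 (proof of Thm. 1.5, display (10)), §1 p. 6 ("Harris' inequality")]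
-/

noncomputable section

namespace Summit.CriticalPhenomena.PercolationContinuityZ3.Theorems

open Literature.Probability.Percolation
open scoped Classical

namespace Antithetic

namespace TwoStage

namespace Cone

variable {V : Type*} [Fintype V]

/-- **A full shifted sum is nonnegative.**  For any pair set `M` (forced red) and monotone nested `F⁻ ≤ F⁺`, `G⁻ ≤ G⁺`:
`0 ≤ Σ_{T'} (F⁺(X(T' ∪ M)) − F⁻(Y(T' ∪ M)))·(G⁺(X(T' ∪ M)) − G⁻(Y(T' ∪ M)))` — Harris in `T'` and the marginal domination
`Σ F⁻(Y(T' ∪ M)) ≤ Σ F⁻(Y T') = Σ F⁻(X T') ≤ Σ F⁺(X(T' ∪ M))`. [this work] -/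
theorem shift_full_sum_nonneg (E : Set (Sym2 V)) (s : V) (M : Set (Sym2 V)) (Fp Fm Gp Gm : Set V → ℝ)
    (hFp : Monotone Fp) (hFm : Monotone Fm) (hF : ∀ S, Fm S ≤ Fp S) (hGp : Monotone Gp) (hGm : Monotone Gm) (hG : ∀ S, Gm S ≤ Gp S) :
    0 ≤ ∑ T' : Set (Sym2 V), (Fp (openCluster ((T' ∪ M) ∩ E) s) - Fm (openCluster ((T' ∪ M)ᶜ ∩ E) s)) *
        (Gp (openCluster ((T' ∪ M) ∩ E) s) - Gm (openCluster ((T' ∪ M)ᶜ ∩ E) s)) := by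
  set N : ℝ := (Fintype.card (Set (Sym2 V)) : ℝ) with hN
  have hNpos : 0 < N := by rw [hN]; exact_mod_cast Fintype.card_pos
  let X : Set (Sym2 V) → Set V := fun T => openCluster (T ∩ E) s
  let Y : Set (Sym2 V) → Set V := fun T => openCluster (Tᶜ ∩ E) s
  have hX : ∀ {T T' : Set (Sym2 V)}, T ⊆ T' → X T ⊆ X T' := fun h => Freeze.openCluster_mono (Set.inter_subset_inter_left E h) s
  have hY : ∀ {T T' : Set (Sym2 V)}, T ⊆ T' → Y T' ⊆ Y T :=
    fun h => Freeze.openCluster_mono (Set.inter_subset_inter_left E (Set.compl_subset_compl.2 h)) s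
  -- the two factors as monotone functions of the fresh variables
  have hmono : ∀ {Ap Am : Set V → ℝ}, Monotone Ap → Monotone Am →
      Monotone (fun T' : Set (Sym2 V) => Ap (X (T' ∪ M)) - Am (Y (T' ∪ M))) := by
    intro Ap Am hAp hAm T₁ T₂ h
    have h' : T₁ ∪ M ⊆ T₂ ∪ M := Set.union_subset_union_left _ h
    exact sub_le_sub (hAp (hX h')) (hAm (hY h'))
  -- marginal domination: each factor has nonnegative total
  have hsum : ∀ {Ap Am : Set V → ℝ}, Monotone Am → (∀ S, Am S ≤ Ap S) →
      0 ≤ ∑ T' : Set (Sym2 V), (Ap (X (T' ∪ M)) - Am (Y (T' ∪ M))) := by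
    intro Ap Am hAm hA
    have h1 : ∀ T' : Set (Sym2 V), Am (X T') - Am (Y T') ≤ Ap (X (T' ∪ M)) - Am (Y (T' ∪ M)) := fun T' =>
      sub_le_sub ((hAm (hX Set.subset_union_left)).trans (hA _)) (hAm (hY Set.subset_union_left))
    have h2 : ∑ T' : Set (Sym2 V), (Am (X T') - Am (Y T')) = 0 := by
      rw [Finset.sum_sub_distrib, sub_eq_zero]
      exact (sum_compl_inter E (fun ω => Am (openCluster ω s))).symm
    calc (0 : ℝ) = ∑ T' : Set (Sym2 V), (Am (X T') - Am (Y T')) := h2.symm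
      _ ≤ _ := Finset.sum_le_sum fun T' _ => h1 T'
  have hH := harris_real (hmono hFp hFm) (hmono hGp hGm)
  rw [← hN] at hH
  have hprod : 0 ≤ (∑ T' : Set (Sym2 V), (Fp (X (T' ∪ M)) - Fm (Y (T' ∪ M)))) *
      ∑ T' : Set (Sym2 V), (Gp (X (T' ∪ M)) - Gm (Y (T' ∪ M))) := mul_nonneg (hsum hFm hF) (hsum hGm hG)
  exact (mul_nonneg_iff_of_pos_left hNpos).1 (hprod.trans hH)

omit [Fintype V] in
/-- **Under the cone hypothesis at `Q`, `Q ∉ Y T` forces every `P ∈ {Q} ∪ N(Q)` into `X T`.**  (On the fibre `S = B T ∌ s` the pairs meeting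
`S` may be recoloured red without changing `X T` — `Cone.fibre_red` — and then `s – Q – P` is red.) [this work] -/
theorem mem_red_of_blue_cluster (E : Set (Sym2 V)) (s P Q : V)
    (hcone : ∀ T : Set (Sym2 V), s ∉ openCluster (Tᶜ ∩ E) Q → ∀ v ∈ openCluster (Tᶜ ∩ E) Q, s(s, v) ∈ E)
    (hPQ : P = Q ∨ s(P, Q) ∈ E) {T : Set (Sym2 V)} (hs : s ∉ openCluster (Tᶜ ∩ E) Q) :
    P ∈ openCluster (T ∩ E) s := by
  set S : Set V := openCluster (Tᶜ ∩ E) Q with hSdef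
  set M : Set (Sym2 V) := {e | ∃ v ∈ e, v ∈ S} with hM
  have hQS : Q ∈ S := mem_openCluster_self _ _
  have hsQ : s ≠ Q := fun h => hs (h ▸ hQS)
  have hred : openCluster ((T ∪ M) ∩ E) s = openCluster (T ∩ E) s :=
    fibre_red E s Q rfl hs (fun v hv => hcone T hs v hv)
  rw [← hred]
  -- the spoke `s Q` is a pair of `E` meeting `S`, hence red in `T ∪ M`
  have hspoke : s(s, Q) ∈ E := hcone T hs Q hQS
  have hQX : Q ∈ openCluster ((T ∪ M) ∩ E) s :=
    mem_cluster_of_adj (mem_openCluster_self _ s)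
      ((openGraph_adj _ s Q).2 ⟨⟨Or.inr ⟨Q, Sym2.mem_mk_right s Q, hQS⟩, hspoke⟩, hsQ⟩)
  by_cases hPQ' : P = Q
  · rw [hPQ']; exact hQX
  · have hE : s(P, Q) ∈ E := hPQ.resolve_left hPQ'
    have hadj : (openGraph ((T ∪ M) ∩ E)).Adj Q P :=
      (openGraph_adj _ Q P).2 ⟨⟨Or.inr ⟨Q, by rw [Sym2.eq_swap]; exact Sym2.mem_mk_right P Q, hQS⟩, by rw [Sym2.eq_swap]; exact hE⟩,
        Ne.symm hPQ'⟩
    exact mem_cluster_of_adj hQX hadj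

/-- **THEOREM M1 — the mixed shifted-BIC sum of a rooted cone at an edge is nonnegative.**  `E` an edge set, `s, Q` vertices such that
every vertex of a blue cluster of `Q` missing `s` is adjacent to `s` (every rooted cone `s * H` with `Q ∈ V(H)`: `Cone.hcone_of_cone`),
`P = Q` or `PQ ∈ E`.  Then for all monotone `F⁻ ≤ F⁺`, `G⁻ ≤ G⁺`:
`0 ≤ Σ_{T : P ∈ X T, Q ∉ Y T} (F⁺(X T) − F⁻(Y T))·(G⁺(X T) − G⁻(Y T))` — hypothesis (M)_shift of the shifted handle principle
(…AntitheticHandlePrincipleShift / …HandleDualShift) for the core `E` at `(P, Q)`. [this work] -/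
theorem mixed_shift_nonneg (E : Set (Sym2 V)) (s P Q : V)
    (hcone : ∀ T : Set (Sym2 V), s ∉ openCluster (Tᶜ ∩ E) Q → ∀ v ∈ openCluster (Tᶜ ∩ E) Q, s(s, v) ∈ E)
    (hPQ : P = Q ∨ s(P, Q) ∈ E)
    (Fp Fm Gp Gm : Set V → ℝ) (hFp : Monotone Fp) (hFm : Monotone Fm) (hF : ∀ S, Fm S ≤ Fp S)
    (hGp : Monotone Gp) (hGm : Monotone Gm) (hG : ∀ S, Gm S ≤ Gp S) :
    0 ≤ ∑ T ∈ Finset.univ.filter (fun T : Set (Sym2 V) => P ∈ openCluster (T ∩ E) s ∧ Q ∉ openCluster (Tᶜ ∩ E) s),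
      (Fp (openCluster (T ∩ E) s) - Fm (openCluster (Tᶜ ∩ E) s)) * (Gp (openCluster (T ∩ E) s) - Gm (openCluster (Tᶜ ∩ E) s)) := by
  -- the event is `{s ∉ B T}`, `B T` the blue cluster of `Q`
  have hev : Finset.univ.filter (fun T : Set (Sym2 V) => P ∈ openCluster (T ∩ E) s ∧ Q ∉ openCluster (Tᶜ ∩ E) s) =
      Finset.univ.filter (fun T : Set (Sym2 V) => s ∉ openCluster (Tᶜ ∩ E) Q) := by
    refine Finset.filter_congr fun T _ => ⟨fun h => fun hs => h.2 (mem_cluster_comm.1 hs), fun hs => ⟨?_, fun hQ => hs (mem_cluster_comm.1 hQ)⟩⟩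
    exact mem_red_of_blue_cluster E s P Q hcone hPQ hs
  rw [hev, Finset.sum_filter]
  -- BHK's display (10): condition on `B T`; each fibre average is a full shifted sum
  rw [cond_sum E s Q hcone (fun A B => (Fp A - Fm B) * (Gp A - Gm B))]
  refine Finset.sum_nonneg fun T _ => ?_
  by_cases hs : s ∉ openCluster (Tᶜ ∩ E) Q
  · rw [if_pos hs]
    exact mul_nonneg (inv_nonneg.2 (Nat.cast_nonneg _)) (shift_full_sum_nonneg E s _ Fp Fm Gp Gm hFp hFm hF hGp hGm hG)
  · rw [if_neg hs]

/-! ### THEOREM CE: cone + ear -/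

omit [Fintype V] in
/-- The stub of length `0` has no pairs. [this work] -/
theorem edgeSet_zero (w : ℕ → V) : Cyc.edgeSet 0 w = ∅ := by
  ext e
  simp only [Cyc.edgeSet, Set.mem_setOf_eq, Set.mem_empty_iff_false, iff_false]
  rintro ⟨i, hi, -⟩
  exact Nat.not_lt_zero i hi

/-- **THEOREM CE (cone + ear, all lengths).**  `E₀` a loop-free edge set through `s` with the cone hypothesis at `Q` (every rooted cone
`s * H`, `Q ∈ V(H)`), `P = Q` or `PQ ∈ E₀`; an arm `u 0 = P, u 1, …, u a = y` of fresh vertices (`a ≥ 0`); `x` fresh, joined to `y` and to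
`Q` (`y ≠ Q`, `yQ ∉ E₀ ∪ arm`).  Then for all monotone `F, G`:
`0 ≤ Σ_{ω : ¬(x ∈ X_E ω ∧ x ∈ Y_E ω)} (F(X_E ω) − F(Y_E ω))·(G(X_E ω) − G(Y_E ω))`, `E = (arm ∪ E₀) + xy + xQ` — the vertex antithetic
inequality at `R = {x}` / CONJECTURE Δ2.  Proof: the shifted handle principle with a `z`-arm of length `0` needs no (⊕) hypothesis, and
(M)_shift is THEOREM M1. [this work] -/
theorem ear_vertex_sum_nonneg {E₀ : Set (Sym2 V)} {s P Q : V} {u : ℕ → V} {a : ℕ}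
    (hnd : ∀ f ∈ E₀, ¬ f.IsDiag)
    (hcone : ∀ T : Set (Sym2 V), s ∉ openCluster (Tᶜ ∩ E₀) Q → ∀ v ∈ openCluster (Tᶜ ∩ E₀) Q, s(s, v) ∈ E₀)
    (hPQ : P = Q ∨ s(P, Q) ∈ E₀)
    (hu0 : u 0 = P) (hufresh : ∀ i, 0 < i → i ≤ a → ∀ f ∈ E₀, u i ∈ f → f.IsDiag)
    (huinj : ∀ i j, i ≤ a → j ≤ a → u i = u j → i = j) (hsu : ∀ i, 0 < i → i ≤ a → s ≠ u i) (hQu : ∀ i, 0 < i → i ≤ a → Q ≠ u i)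
    {x : V} (hx : ∀ f ∈ Cyc.edgeSet a u ∪ E₀, x ∈ f → f.IsDiag) (hxs : x ≠ s) (hxy : x ≠ u a) (hxQ : x ≠ Q) (hyQ : u a ≠ Q)
    (hg : s(u a, Q) ∉ Cyc.edgeSet a u ∪ E₀)
    {F G : Set V → ℝ} (hF : Monotone F) (hG : Monotone G) :
    0 ≤ ∑ ω ∈ Finset.univ.filter (fun ω : Set (Sym2 V) =>
        ¬ ((openGraph (ω ∩ insert s(x, u a) (insert s(x, Q) (Cyc.edgeSet a u ∪ E₀)))).Reachable s x ∧
          (openGraph (ωᶜ ∩ insert s(x, u a) (insert s(x, Q) (Cyc.edgeSet a u ∪ E₀)))).Reachable s x)),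
      (F (openCluster (ω ∩ insert s(x, u a) (insert s(x, Q) (Cyc.edgeSet a u ∪ E₀))) s) -
          F (openCluster (ωᶜ ∩ insert s(x, u a) (insert s(x, Q) (Cyc.edgeSet a u ∪ E₀))) s)) *
        (G (openCluster (ω ∩ insert s(x, u a) (insert s(x, Q) (Cyc.edgeSet a u ∪ E₀))) s) -
          G (openCluster (ωᶜ ∩ insert s(x, u a) (insert s(x, Q) (Cyc.edgeSet a u ∪ E₀))) s)) := by
  -- the `z`-arm of length `0`: `w 0 = Q`, no stub pairs
  let w : ℕ → V := fun _ => Q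
  have hw0 : w 0 = Q := rfl
  have hE : Cyc.edgeSet a u ∪ E₀ = (Cyc.edgeSet a u ∪ E₀) ∪ Cyc.edgeSet 0 w := by rw [edgeSet_zero, Set.union_empty]
  have hufresh' : ∀ i, 0 < i → i ≤ a → ∀ f ∈ E₀ ∪ Cyc.edgeSet 0 w, u i ∈ f → f.IsDiag := by
    intro i hi hia f hf huf
    rw [edgeSet_zero, Set.union_empty] at hf
    exact hufresh i hi hia f hf huf
  have h := Pendant.handle_vertex_sum_nonneg_of_shift (E₀ := E₀) (s := s) (P := P) (Q := Q) (u := u) (w := w) (a := a) (b := 0)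
    hu0 hw0 hufresh' (fun i hi hib => absurd hib (by omega)) huinj (fun i j hi hj _ => by omega) hsu
    (fun i hi hib => absurd hib (by omega)) (fun i hi hib => absurd hib (by omega)) hQu
    (fun j hj => absurd hj (Nat.not_lt_zero j))
    (fun Fp Fm Gp Gm hFp hFm hF' hGp hGm hG' => mixed_shift_nonneg E₀ s P Q hcone hPQ Fp Fm Gp Gm hFp hFm hF' hGp hGm hG')
    hnd (x := x) (by rw [← hE]; exact hx) hxs hxy hxQ hyQ (by rw [← hE]; exact hg) hF hG
  rw [← hE] at h
  exact h

end Cone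

end TwoStage

end Antithetic

end Summit.CriticalPhenomena.PercolationContinuityZ3.Theorems
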